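import Summits.QuantumFields.YangMills.Theorems.BalabanUVNodesN22TermStepRecursion
import Summits.QuantumFields.YangMills.Theorems.BalabanUVNodesN22AtRecordOfKernelFadingAgeWeighted

/-!
# BalabanUVNodes ∕ node N22 = NE9 — THE TERM-LEVEL RECURSION-CURRENCY EDITION AT THE RECORD: K3's `h9` WITH THE RECORD's GEOMETRIC MODULI from node N18's kernel step rate +
# the THREE TERM-LEVEL STEP SCHEMAS of the renormalization recursion on node00-def-W1's (2.13) terms of the towers `S K` + the printed-type output bound + readings ∕ tails ∕
# W1-20's law ∕ (1.21) — J49 §2 with its term letter `hΔ` DISCHARGED by module J51; NO smallness of the recursion's growth, only the row `ℓ.θ₅·ν ≤ ℓ.ω²`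

Cell `pub-ymgap`, HUMAN RULING D-0062 (Track A), R134 seat `pub-ymgap-dag-n22-c` (strategy s1), generation 17, module J52.  THEOREMS ONLY (no `def`, no `sorry`, standard axioms);
`--kind proof --supports stmt-QuantumFields-27366 --as helper` (K3⁸ `SpineGivenEndpointR13SepCoPHV`, skeleton v6 — §2b N22 face `h9` verbatim), COUNT-NEUTRAL.  Imports module J51
`…N22TermStepRecursion` (`termSecondDiffAt_box_of_termStepRecursion`: the term-level second-difference letter with table `L₂·ν^{k−i}` from the term-level schemas (T1), (T2-last),
(T2-old), via the re-twist device) and module J49 `…N22AtRecordOfKernelFadingAgeWeighted` (`ne9_EA_objectsOfRecord₁₃_of_kernelStepRate_termSecondDiffGrowing_outputBound`; through it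
J48, J45∕J46, J41, node N18's junctions and dag-n22-w3's pin face).  Nothing re-declared; the three theorems are ONE application each.

WHY.  Module J50 stated K3's `h9` in RECURSION currency with the step inequalities displayed ON THE LIMITING KERNELS OF RECORD — an honest abstraction, but not the level at which
[I] (2.13)'s recursion lives: the term `E^{(k+1)}(X; g; φ)` created at step `k + 1` depends on the older couplings through the OLDER TERMS (before localization, windows and limits),
so a producer (node N10 ∕ NODE A ∕ def-W1's generator) meets the schemas on the TERMS of each torus tower `S K`, uniformly in `K`.  Module J51 runs pub-balaban's ROAD 1 and
dag-n22-a's second-order recursion BY NAME on those complex terms (re-twist) and delivers exactly J45∕J49's term-level letter `hΔ` with the age-growing table `L₂·ν^{k−i}`,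
`L₂ = max ℓ₂ (c_b ℓ₁²∕(ν − ω₁ − c))`; J49 §2 then passes it through W1-20's law, the windows and (1.21) (J48 §1–§2) and knits with node N18's kernel step rate (J48 §3–§4).
* §1 ★★★ `ne9_EA_objectsOfRecord₁₃_of_kernelStepRate_termStepRecursion` — AT THE RECORD: node N18's `KernelStepRateOfRecord₁₃ F N θ κ₅ ℓ.θ₅ C₅`; ON EVERY TORUS TOWER `S K` the
  term-level schemas (T1) (`lam K k ≤ ℓ₁`), (T2-last) (`lam₂ K k ≤ ℓ₂`), (T2-old) with channel weights `0 ≤ a K k j ≤ c·ω₁^{k−j}`, `0 ≤ b K k j ≤ c_b·ω₁^{k−j}` (constants UNIFORM in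
  `K`, families free in `K`), on the space tables `sp K k X` with term decay rate `κ_E`; a growth rate `ν` with `ω₁ + c < ν`, `(ω₁ + c)² ≤ ν`, `1 ≤ ν`; the printed-type OUTPUT bound
  `‖E^{(k+1)}(X; g; φ)‖ ≤ B·e^{−κ_E d_{k+1}(X)}` on the tables; term holomorphy through the complexified readings of record, chart ∕ space clauses, site-weight tails
  (`w ≤ B₃e^{−δ₀·dist}`), `2κ₀(64,8) ≤ κ ≤ κ_E`; W1-20's law `Localizes17OfRecord₁₃ F N θ S emb`; (1.21) `PolLimitsExistOfRecord₁₃ F N θ`; the ROWS `δ₁ ≤ κ₅`, `0 < ℓ.ω`,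
  **`ℓ.θ₅·ν ≤ ℓ.ω²`**, `ℓ.κ ≤ δ₁`, `(4·(2C₅∕(1−ℓ.θ₅) + 2E₁)∕θ.γ + C₂·θ.γ∕2)∕ℓ.ω ≤ ℓ.C₉` with `E₁ = (16BB₃²∕r²)e^{12Mδ₁}K₀K₁`, `C₂ = (16L₂B₃²∕r²)e^{12Mδ₁}K₀K₁` ⟹
  **`NE9 ((objectsOfRecord₁₃ F N θ ℓ).EA 0) (Window θ.γ) ℓ.κ ℓ.moduli`**.  NO smallness of `ω₁ + c`; NO coupling disc, sector or chart in the couplings; NO age-uniform constant.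
* §2 ★★★ `n22At_u3OfRecord₁₃_of_kernelStepRate_termStepRecursion` — THE KERNEL-FACE SOCKET EDITION: the same inputs ⟹ **`∀ k, N22At (u3OfRecord₁₃ θ (objectsOfRecord₁₃ F N θ ℓ) k)`**
  — the `h22` row of dag-n27-c's K3⁸ leaf `…AllPinsOfRecord13CoPHVCutBFreeBareLedgerReadingKernelFaces` (bus 2026-08-28 16:27Z: «the node-U3 share reads … ONE N22 face at the
  LIMITING kernels of record»), by dag-n22-w3's `n22At_u3OfRecord₁₃_objectsOfRecord₁₃_iff` on §1 — a ROAD-2 plug in term-level recursion currency, by `exact`.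
* §3 ★★★ the pin face `n22At_rateCarriers_of_kernels_pin_of_kernelStepRate_termStepRecursion` (every run length `k`, under `hpin`; dag-n22-w3's pin form).
THE N22 ROW SENTENCE in term-level recursion currency: «node N18's kernel step rate + the first- and second-order Lipschitz structure of the step map {last coupling, older TERMS} ↦
new TERM on every torus, with geometrically weighted channels, at the complex configurations of the space tables + (1.18) + the readings, the law and (1.21) ⟹ K3's `h9` with the
record's GEOMETRIC moduli, whenever N18's rate beats the recursion's growth: `θ₅·ν ≤ ω² < 1`, `ν = max(1, (ω₁+c)⁺, (ω₁+c)²)`».  The rows are jointly satisfiable with `ℓ.Signs` iff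
`θ₅ν < 1` — J48 §5 `exists_letterBlock_rows_growing` at `q := ν` (A5).

DISPLAYED INPUTS by owner.  N18's `KernelStepRateOfRecord₁₃`: node N18 (NE5 NOT PRINTED for d = 4).  (T1)∕(T2-last)∕(T2-old) on the terms: cell NEW-ESTIMATE SHAPES, NOT PRINTED
(pub-balaban GAPS G-t4-U3-1∕-3; [I] prints the recursion (0.23) p. 256, (2.12)–(2.13) p. 268, the last-coupling C^∞ clause p. 263 «(or analytic)» without constants, «vanishes at
g_k = 0», and «depends also on all preceding coupling constants» p. 298 — NOTHING quantitative in the older couplings): node N10 ([II] Lemmas 1–3 differentiated in one older coupling —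
inspection-level) ∕ NODE A ∕ def-W1's generator `HistoryRecursionOfRecord.GenTower`.  Output bound: printed TYPE (1.18) p. 263 ∕ [II] (2.41) p. 21, N10 ∕ NODE A at the towers of
record.  Readings ∕ chart ∕ space clauses ∕ tails: NODE A ∕ N09 ([I] p. 282, the sentence after (4.4); (4.35)–(4.37) pp. 290–291).  Law: NODE A ∕ def-W1 (towers `S K` NAMED by NODE A —
trigger (t10)).  (1.21): dag-n22-w3's road.  The schemas are met by every history-free tower (A5: content = the composition's shape, conditional).

HONEST FRAMING (binding).  Count-neutral COMPOSITION of landed theorems by name; NO estimate of Bałaban's is proved or asserted; nothing of the record is constructed or claimed to meet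
the displayed inputs; coefficient algebra `𝔸 : Type` (J51).  N22 is NOT discharged (typed 28∕28 · discharged 5∕27 UNCHANGED); K3⁸ OPEN and NOT claimed (no stub of 27366 touched);
NE9 is NOT IN PRINT for d = 4; no count claim; one finite 𝕋⁴ programme at fixed ε — R4 closes the CONDITIONAL rung `BalabanLadder.UV` only; NOTHING about the continuum limit, ℝ⁴,
infinite volume, OS axioms, a mass gap or the Clay problem is proved or claimed.  References (TYPES only, no cite tags on the Summit side): [I] = Bałaban, CMP 109 (1987) Thm 1 p. 259,
(0.23) p. 256, §1 p. 263 with (1.18), (1.20)–(1.22) p. 264, (2.12)–(2.13) p. 268, p. 282, (4.35)–(4.37) pp. 290–291, §5 p. 298; [II] = CMP 116 (1988) (2.13)–(2.14) pp. 14–15,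
(2.41) p. 21; King, CMP 102 (1986) Lemma 4.5 (the N18 mechanism's print).
-/

noncomputable section

open Filter Topology Set Metric
open scoped BigOperators

namespace YMDAG.N22.KernelFading

open Literature.MathematicalPhysics.QuantumFieldTheory.Balaban1983to89
open Literature.MathematicalPhysics.QuantumFieldTheory.Balaban1983to89.T4Continuum (T4Family ULoop)
open Literature.MathematicalPhysics.QuantumFieldTheory.Balaban1983to89.T4OutputRate (Window NE9)
open Literature.MathematicalPhysics.QuantumFieldTheory.Balaban1983to89.TreeLengthTorus (TPt)
open Literature.MathematicalPhysics.QuantumFieldTheory.Balaban1983to89.B12TreeDecay (K₀ kappa₀)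
open Literature.MathematicalPhysics.QuantumFieldTheory.Balaban1983to89.B12Decay510 (delta1)
open Literature.MathematicalPhysics.QuantumFieldTheory.Balaban1983to89.B12Decay510Window (K₁)
open Literature.MathematicalPhysics.QuantumFieldTheory.Balaban1983to89.B12Decay510Torus (distCT nearT)
open Literature.MathematicalPhysics.QuantumFieldTheory.Balaban1983to89.Node00 (Stage13Params Stage13HParams U3Letters₁₁ MatA)
open Literature.MathematicalPhysics.QuantumFieldTheory.Balaban1983to89.Node00.Sect2 (domSys domCount CPair)
open Literature.MathematicalPhysics.QuantumFieldTheory.Balaban1983to89.Node00.W1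
open Literature.MathematicalPhysics.QuantumFieldTheory.Balaban1983to89.Node00.LocalizedSum17 (ReadingMaps Localizes17OfRecord₁₃)
open Literature.MathematicalPhysics.QuantumFieldTheory.Balaban1983to89.Node00.U3OfKernels (histPrefix objectsOfRecord₁₃)
open Literature.MathematicalPhysics.QuantumFieldTheory.Balaban1983to89.Node00.U3KernelLetters (KernelStepRateOfRecord₁₃ PolLimitsExistOfRecord₁₃)
open YMDAG.UVSplit (N22At u3OfRecord₁₃ RateReading₁₃CoPH rateCarriersOfRecord₁₃CoPH)
open YMDAG.N22.AtKernels (n22At_rateCarriers_of_kernels_pin_of_ne9 n22At_u3OfRecord₁₃_objectsOfRecord₁₃_iff)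
open YMDAG.N22.TermRecursion (termSecondDiffAt_box_of_termStepRecursion)

open scoped Matrix.Norms.L2Operator

variable (F : T4Family) (N : ℕ) [NeZero N] {𝔸 : Type} {M : ℕ}

/-! ## §1 ★★★ K3's `h9` from node N18's kernel step rate + the term-level step schemas on the towers + the output bound -/

open Classical Finset in
/-- ★★★ **K3's `h9` WITH THE RECORD's MODULI FROM NODE N18's KERNEL STEP RATE + THE TERM-LEVEL FIRST- AND SECOND-ORDER STEP SCHEMAS ON EVERY TORUS TOWER + THE OUTPUT BOUND — NO
SMALLNESS OF THE RECURSION's GROWTH.**  At a Stage-13 tuple `θ` (`0 < θ.γ`) with a letter block `ℓ` (`ℓ.Signs`): (N18) `KernelStepRateOfRecord₁₃ F N θ κ₅ ℓ.θ₅ C₅`; for node00-def-W1's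
towers `S K` read through `emb` with W1-20's law and (1.21): ON EVERY `S K` the term-level schemas (T1) (`lam K k ≤ ℓ₁`), (T2-last) (`lam₂ K k ≤ ℓ₂`), (T2-old) with channels `a K`, `b K`,
weights `0 ≤ a K k j ≤ c·ω₁^{k−j}`, `0 ≤ b K k j ≤ c_b·ω₁^{k−j}`, at the space tables `sp K` with decay rate `κ_E`; rows `ω₁ + c < ν`, `(ω₁ + c)² ≤ ν`, `1 ≤ ν`; the printed-type output
bound `hbd`; term holomorphy through the complexified readings (`hEhol`, chart `hΦemb`, space clause `hΦsp`), site weights and tails; `2κ₀(64,8) ≤ κ ≤ κ_E`; the letter rows with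
**`ℓ.θ₅·ν ≤ ℓ.ω²`** and the `C₉` row at `C₂ = (16L₂B₃²∕r²)e^{12Mδ₁}K₀K₁`, `L₂ = max ℓ₂ (c_b ℓ₁²∕(ν − ω₁ − c))` ⟹ **`NE9 ((objectsOfRecord₁₃ F N θ ℓ).EA 0) (Window θ.γ) ℓ.κ ℓ.moduli`**
— module J51's `termSecondDiffAt_box_of_termStepRecursion` at every torus (tables non-empty by `hΦsp` at `z = 0`) supplies J49 §2's `hΔ` with `M₂ := L₂`, `q := ν`.  LOCATED
(hypothesis form: the schemas are pub-balaban's ∕ dag-n22-a's UNPRINTED shapes read on the (2.13) terms); N22 NOT discharged. [folklore] -/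
theorem ne9_EA_objectsOfRecord₁₃_of_kernelStepRate_termStepRecursion (θ : Stage13Params F N) (ℓ : U3Letters₁₁) (hs : ℓ.Signs) (hγ : 0 < θ.γ)
    (hlim : PolLimitsExistOfRecord₁₃ F N θ) {κ₅ C₅ : ℝ} (hC₅ : 0 ≤ C₅) (h5 : KernelStepRateOfRecord₁₃ F N θ κ₅ ℓ.θ₅ C₅)
    (m' : ℕ) (M : ℕ) [NeZero M] (hM : M = F.L ^ m')
    (S : (K : ℕ) → ClusterTower (F.P K) 𝔸 M) (emb : ReadingMaps F (MatA N) 𝔸) (hloc : Localizes17OfRecord₁₃ F N θ S emb)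
    (sp : (K k : ℕ) → (domSys (F.P K) M (k + 1)).Dom → Set (CPair (F.P K) 𝔸))
    {κ κE δ₀ B₃ r B ℓ₁ ℓ₂ c cb ω₁ ν : ℝ} {lam lam₂ : ℕ → ℕ → ℝ} {a b : ℕ → ℕ → ℕ → ℝ}
    (hκ₀ : kappa₀ (4 * 2 ^ 4) (2 * 4) ≤ κ / 2) (hδ₀ : 0 < δ₀) (hB₃ : 0 ≤ B₃) (hr : 0 < r) (hB : 0 ≤ B) (hκE : κ ≤ κE)
    (hT1 : ∀ K, ∀ g ∈ Window θ.γ, ∀ g' ∈ Window θ.γ, ∀ (D : ℕ → ℝ) (k : ℕ),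
      (∀ k' < k, ∀ (X' : (domSys (F.P K) M (k' + 1)).Dom), ∀ φ' ∈ sp K k' X',
        ‖termC (S K) (k' + 1) X' g φ' - termC (S K) (k' + 1) X' g' φ'‖ ≤ Real.exp (-(κE * (domSys (F.P K) M (k' + 1)).dj X')) * D (k' + 1)) →
      ∀ (X : (domSys (F.P K) M (k + 1)).Dom), ∀ φ ∈ sp K k X,
        ‖termC (S K) (k + 1) X g φ - termC (S K) (k + 1) X g' φ‖ ≤
          Real.exp (-(κE * (domSys (F.P K) M (k + 1)).dj X)) * (lam K k * |g k - g' k| + ∑ j ∈ range (k + 1), a K k j * D j))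
    (hlam : ∀ K k, lam K k ≤ ℓ₁) (hℓ₁ : 0 ≤ ℓ₁)
    (hT2last : ∀ K, ∀ g ∈ Window θ.γ, ∀ (k : ℕ) (t d : ℝ), 0 < d → t - d ∈ Ioc (0 : ℝ) θ.γ → t + d ∈ Ioc (0 : ℝ) θ.γ →
      ∀ (X : (domSys (F.P K) M (k + 1)).Dom), ∀ φ ∈ sp K k X,
        ‖termC (S K) (k + 1) X (Function.update g k (t + d)) φ - 2 * termC (S K) (k + 1) X (Function.update g k t) φ +
            termC (S K) (k + 1) X (Function.update g k (t - d)) φ‖ ≤ Real.exp (-(κE * (domSys (F.P K) M (k + 1)).dj X)) * (lam₂ K k * d ^ 2))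
    (hT2old : ∀ K, ∀ g ∈ Window θ.γ, ∀ (i : ℕ) (t d : ℝ), 0 < d → t - d ∈ Ioc (0 : ℝ) θ.γ → t + d ∈ Ioc (0 : ℝ) θ.γ →
      ∀ (D₁ D₂ : ℕ → ℝ) (k : ℕ), i < k →
        (∀ k' < k, ∀ (X' : (domSys (F.P K) M (k' + 1)).Dom), ∀ φ' ∈ sp K k' X',
          ‖termC (S K) (k' + 1) X' (Function.update g i (t + d)) φ' - termC (S K) (k' + 1) X' (Function.update g i t) φ'‖ ≤
              Real.exp (-(κE * (domSys (F.P K) M (k' + 1)).dj X')) * D₁ (k' + 1) ∧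
          ‖termC (S K) (k' + 1) X' (Function.update g i t) φ' - termC (S K) (k' + 1) X' (Function.update g i (t - d)) φ'‖ ≤
              Real.exp (-(κE * (domSys (F.P K) M (k' + 1)).dj X')) * D₁ (k' + 1) ∧
          ‖termC (S K) (k' + 1) X' (Function.update g i (t + d)) φ' - 2 * termC (S K) (k' + 1) X' (Function.update g i t) φ' +
              termC (S K) (k' + 1) X' (Function.update g i (t - d)) φ'‖ ≤ Real.exp (-(κE * (domSys (F.P K) M (k' + 1)).dj X')) * D₂ (k' + 1)) →
        ∀ (X : (domSys (F.P K) M (k + 1)).Dom), ∀ φ ∈ sp K k X,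
          ‖termC (S K) (k + 1) X (Function.update g i (t + d)) φ - 2 * termC (S K) (k + 1) X (Function.update g i t) φ +
              termC (S K) (k + 1) X (Function.update g i (t - d)) φ‖ ≤
            Real.exp (-(κE * (domSys (F.P K) M (k + 1)).dj X)) * ∑ j ∈ range (k + 1), (a K k j * D₂ j + b K k j * D₁ j ^ 2))
    (ha : ∀ K k j, j ≤ k → 0 ≤ a K k j ∧ a K k j ≤ c * ω₁ ^ (k - j)) (hb : ∀ K k j, j ≤ k → 0 ≤ b K k j ∧ b K k j ≤ cb * ω₁ ^ (k - j))
    (hlam₂ : ∀ K k, lam₂ K k ≤ ℓ₂) (hℓ₂ : 0 ≤ ℓ₂) (hc : 0 ≤ c) (hcb : 0 ≤ cb) (hω₁ : 0 ≤ ω₁) (hν : ω₁ + c < ν) (hμν : (ω₁ + c) ^ 2 ≤ ν) (hν1 : 1 ≤ ν)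
    (hbd : ∀ g ∈ Window θ.γ, ∀ (K k : ℕ) (X : (domSys (F.P K) M (k + 1)).Dom), ∀ φ ∈ sp K k X,
      ‖((S K) k).E (histPrefix g k) φ X‖ ≤ B * Real.exp (-(κE * (domSys (F.P K) M (k + 1)).dj X)))
    (Ec : ℕ → ℕ → Type*) [∀ K k, NormedAddCommGroup (Ec K k)] [∀ K k, NormedSpace ℂ (Ec K k)]
    (ι : letI := θ.instVβ₁; letI := θ.instVβ₂
      (K k : ℕ) → (domSys (F.P K) M (k + 1)).Dom → ((Fin (F.P K).d → Site (F.P K) (k + 1) → θ.Vβ) →L[ℝ] Ec K k))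
    (Φ : (K k : ℕ) → (domSys (F.P K) M (k + 1)).Dom → Ec K k → CPair (F.P K) 𝔸)
    (U : (K k : ℕ) → (domSys (F.P K) M (k + 1)).Dom → Set (Ec K k)) (hU : ∀ K k X, IsOpen (U K k X)) (hrU : ∀ K k X, ball (0 : Ec K k) r ⊆ U K k X)
    (hEhol : ∀ g ∈ Window θ.γ, ∀ (K k : ℕ) (X : (domSys (F.P K) M (k + 1)).Dom),
      DifferentiableOn ℂ (fun z => ((S K) k).E (histPrefix g k) (Φ K k X z) X) (U K k X))
    (hΦemb : letI := θ.instVβ₁; letI := θ.instVβ₂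
      ∀ (K k : ℕ) (X : (domSys (F.P K) M (k + 1)).Dom) (Bf : Fin (F.P K).d → Site (F.P K) (k + 1) → θ.Vβ),
        Φ K k X (ι K k X Bf) = emb K k (fun l t => NormedSpace.exp (θ.ρ8 (Bf l t))))
    (hΦsp : ∀ (K k : ℕ) (X : (domSys (F.P K) M (k + 1)).Dom), ∀ z ∈ ball (0 : Ec K k) r, Φ K k X z ∈ sp K k X)
    (w : (K k : ℕ) → (domSys (F.P K) M (k + 1)).Dom → Site (F.P K) (k + 1) → ℝ) (hw₀ : ∀ K k X t, 0 ≤ w K k X t)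
    (hw : letI := θ.instVβ₁; letI := θ.instVβ₂; letI := θ.instιβ
      ∀ (K k : ℕ) (X : (domSys (F.P K) M (k + 1)).Dom) (l : Fin (F.P K).d) (t : Site (F.P K) (k + 1)) (c : θ.ιβ),
        ‖ι K k X (Pi.single l (Pi.single t (θ.bV c)))‖ ≤ w K k X t)
    (htail : ∀ (K k : ℕ) (X : (domSys (F.P K) M (k + 1)).Dom) (t : Site (F.P K) (k + 1)),
      let e : Site (F.P K) (k + 1) → TPt 4 (domCount (F.P K) M (k + 1) * M) := fun x i => (ZMod.cast (x i) : ZMod (domCount (F.P K) M (k + 1) * M))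
      w K k X t ≤ B₃ * Real.exp (-δ₀ * distCT (domCount (F.P K) M (k + 1)) M (e t) (nearT (M := M) (e t) X)))
    (hκ₅ : delta1 δ₀ κ ((M : ℝ) * 4) ≤ κ₅)
    (hω : 0 < ℓ.ω) (hθω : ℓ.θ₅ * ν ≤ ℓ.ω ^ 2) (hℓκ : ℓ.κ ≤ delta1 δ₀ κ ((M : ℝ) * 4))
    (hC₉ : (4 * (2 * C₅ / (1 - ℓ.θ₅) + 2 * ((16 * B * B₃ ^ 2 / r ^ 2) * Real.exp (delta1 δ₀ κ ((M : ℝ) * 4) * ((M : ℝ) * 4) * 3) * K₀ (4 * 2 ^ 4) (2 * 4) * K₁ 4 (δ₀ / 2))) / θ.γ +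
        ((16 * max ℓ₂ (cb * ℓ₁ ^ 2 / (ν - ω₁ - c)) * B₃ ^ 2 / r ^ 2) * Real.exp (delta1 δ₀ κ ((M : ℝ) * 4) * ((M : ℝ) * 4) * 3) * K₀ (4 * 2 ^ 4) (2 * 4) *
          K₁ 4 (δ₀ / 2)) * θ.γ / 2) / ℓ.ω ≤ ℓ.C₉) :
    NE9 ((objectsOfRecord₁₃ F N θ ℓ).EA 0) (Window θ.γ) ℓ.κ ℓ.moduli := by
  have hL₂ : 0 ≤ max ℓ₂ (cb * ℓ₁ ^ 2 / (ν - ω₁ - c)) := hℓ₂.trans (le_max_left _ _)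
  -- module J51 at every torus: the term-level letter `hΔ` with table `L₂·ν^{k−i}` (tables non-empty through the chart at `z = 0`)
  have hsp : ∀ (K k : ℕ) (X : (domSys (F.P K) M (k + 1)).Dom), (sp K k X).Nonempty := fun K k X => ⟨Φ K k X 0, hΦsp K k X 0 (mem_ball_self hr)⟩
  have hΔ : ∀ (K k : ℕ) (i : Fin (k + 1)), ∀ g ∈ box θ.γ k, ∀ (X : (domSys (F.P K) M (k + 1)).Dom), ∀ φ ∈ sp K k X, ∀ t d : ℝ, 0 < d →
      t - d ∈ Ioc (0 : ℝ) θ.γ → t + d ∈ Ioc (0 : ℝ) θ.γ →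
        ‖((S K) k).E (Function.update g i (t + d)) φ X - 2 * ((S K) k).E (Function.update g i t) φ X + ((S K) k).E (Function.update g i (t - d)) φ X‖ ≤
          max ℓ₂ (cb * ℓ₁ ^ 2 / (ν - ω₁ - c)) * ν ^ (k - (i : ℕ)) * Real.exp (-(κE * (domSys (F.P K) M (k + 1)).dj X)) * d ^ 2 := fun K =>
    termSecondDiffAt_box_of_termStepRecursion (S K) (sp K) (hsp K) hγ (hT1 K) (hlam K) hℓ₁ (hT2last K) (hT2old K) (ha K) (hb K) (hlam₂ K) hℓ₂ hc hcb hω₁ hν hμν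
  exact ne9_EA_objectsOfRecord₁₃_of_kernelStepRate_termSecondDiffGrowing_outputBound F N θ ℓ hs hγ hlim hC₅ h5 m' M hM S emb hloc sp hκ₀ hδ₀ hB₃ hr hL₂ hν1 hB hκE hΔ hbd
    Ec ι Φ U hU hrU hEhol hΦemb hΦsp w hw₀ hw htail hκ₅ hω hθω hℓκ hC₉

/-! ## §2 ★★★ The kernel-face socket: `N22At` at the node-U3 objects of record, every run length -/

open Classical Finset in
/-- ★★★ **THE KERNEL-FACE SOCKET EDITION** — §1's inputs ⟹ **`N22At (u3OfRecord₁₃ θ (objectsOfRecord₁₃ F N θ ℓ) k)` for EVERY run length `k`**: the N22 face «at the LIMITING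
kernels of record» asked by dag-n27-c's K3⁸ leaf `…KernelFaces` (row `h22 : … ∀ k, N22At (u3OfRecord₁₃ θ.toStage13Params (objectsOfRecord₁₃ F N θ.toStage13Params (ℓ F θ)) k)`), by
dag-n22-w3's level-free `n22At_u3OfRecord₁₃_objectsOfRecord₁₃_iff` on §1.  THE N22 ROW SENTENCE in term-level recursion currency: «node N18's kernel step rate of record + the
first- and second-order step schemas of the recursion on the (2.13) TERMS of every torus tower with geometrically weighted channels + the printed-type output bound + term
holomorphy through the readings + tails + W1-20's law + (1.21) + letter rows with `ℓ.θ₅·ν ≤ ℓ.ω²` ⇒ the N22 kernel face — NO smallness of the recursion's growth».  LOCATED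
(hypothesis form); N22 NOT discharged. [folklore] -/
theorem n22At_u3OfRecord₁₃_of_kernelStepRate_termStepRecursion (θ : Stage13Params F N) (ℓ : U3Letters₁₁) (hs : ℓ.Signs) (hγ : 0 < θ.γ)
    (hlim : PolLimitsExistOfRecord₁₃ F N θ) {κ₅ C₅ : ℝ} (hC₅ : 0 ≤ C₅) (h5 : KernelStepRateOfRecord₁₃ F N θ κ₅ ℓ.θ₅ C₅)
    (m' : ℕ) (M : ℕ) [NeZero M] (hM : M = F.L ^ m')
    (S : (K : ℕ) → ClusterTower (F.P K) 𝔸 M) (emb : ReadingMaps F (MatA N) 𝔸) (hloc : Localizes17OfRecord₁₃ F N θ S emb)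
    (sp : (K k : ℕ) → (domSys (F.P K) M (k + 1)).Dom → Set (CPair (F.P K) 𝔸))
    {κ κE δ₀ B₃ r B ℓ₁ ℓ₂ c cb ω₁ ν : ℝ} {lam lam₂ : ℕ → ℕ → ℝ} {a b : ℕ → ℕ → ℕ → ℝ}
    (hκ₀ : kappa₀ (4 * 2 ^ 4) (2 * 4) ≤ κ / 2) (hδ₀ : 0 < δ₀) (hB₃ : 0 ≤ B₃) (hr : 0 < r) (hB : 0 ≤ B) (hκE : κ ≤ κE)
    (hT1 : ∀ K, ∀ g ∈ Window θ.γ, ∀ g' ∈ Window θ.γ, ∀ (D : ℕ → ℝ) (k : ℕ),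
      (∀ k' < k, ∀ (X' : (domSys (F.P K) M (k' + 1)).Dom), ∀ φ' ∈ sp K k' X',
        ‖termC (S K) (k' + 1) X' g φ' - termC (S K) (k' + 1) X' g' φ'‖ ≤ Real.exp (-(κE * (domSys (F.P K) M (k' + 1)).dj X')) * D (k' + 1)) →
      ∀ (X : (domSys (F.P K) M (k + 1)).Dom), ∀ φ ∈ sp K k X,
        ‖termC (S K) (k + 1) X g φ - termC (S K) (k + 1) X g' φ‖ ≤
          Real.exp (-(κE * (domSys (F.P K) M (k + 1)).dj X)) * (lam K k * |g k - g' k| + ∑ j ∈ range (k + 1), a K k j * D j))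
    (hlam : ∀ K k, lam K k ≤ ℓ₁) (hℓ₁ : 0 ≤ ℓ₁)
    (hT2last : ∀ K, ∀ g ∈ Window θ.γ, ∀ (k : ℕ) (t d : ℝ), 0 < d → t - d ∈ Ioc (0 : ℝ) θ.γ → t + d ∈ Ioc (0 : ℝ) θ.γ →
      ∀ (X : (domSys (F.P K) M (k + 1)).Dom), ∀ φ ∈ sp K k X,
        ‖termC (S K) (k + 1) X (Function.update g k (t + d)) φ - 2 * termC (S K) (k + 1) X (Function.update g k t) φ +
            termC (S K) (k + 1) X (Function.update g k (t - d)) φ‖ ≤ Real.exp (-(κE * (domSys (F.P K) M (k + 1)).dj X)) * (lam₂ K k * d ^ 2))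
    (hT2old : ∀ K, ∀ g ∈ Window θ.γ, ∀ (i : ℕ) (t d : ℝ), 0 < d → t - d ∈ Ioc (0 : ℝ) θ.γ → t + d ∈ Ioc (0 : ℝ) θ.γ →
      ∀ (D₁ D₂ : ℕ → ℝ) (k : ℕ), i < k →
        (∀ k' < k, ∀ (X' : (domSys (F.P K) M (k' + 1)).Dom), ∀ φ' ∈ sp K k' X',
          ‖termC (S K) (k' + 1) X' (Function.update g i (t + d)) φ' - termC (S K) (k' + 1) X' (Function.update g i t) φ'‖ ≤
              Real.exp (-(κE * (domSys (F.P K) M (k' + 1)).dj X')) * D₁ (k' + 1) ∧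
          ‖termC (S K) (k' + 1) X' (Function.update g i t) φ' - termC (S K) (k' + 1) X' (Function.update g i (t - d)) φ'‖ ≤
              Real.exp (-(κE * (domSys (F.P K) M (k' + 1)).dj X')) * D₁ (k' + 1) ∧
          ‖termC (S K) (k' + 1) X' (Function.update g i (t + d)) φ' - 2 * termC (S K) (k' + 1) X' (Function.update g i t) φ' +
              termC (S K) (k' + 1) X' (Function.update g i (t - d)) φ'‖ ≤ Real.exp (-(κE * (domSys (F.P K) M (k' + 1)).dj X')) * D₂ (k' + 1)) →
        ∀ (X : (domSys (F.P K) M (k + 1)).Dom), ∀ φ ∈ sp K k X,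
          ‖termC (S K) (k + 1) X (Function.update g i (t + d)) φ - 2 * termC (S K) (k + 1) X (Function.update g i t) φ +
              termC (S K) (k + 1) X (Function.update g i (t - d)) φ‖ ≤
            Real.exp (-(κE * (domSys (F.P K) M (k + 1)).dj X)) * ∑ j ∈ range (k + 1), (a K k j * D₂ j + b K k j * D₁ j ^ 2))
    (ha : ∀ K k j, j ≤ k → 0 ≤ a K k j ∧ a K k j ≤ c * ω₁ ^ (k - j)) (hb : ∀ K k j, j ≤ k → 0 ≤ b K k j ∧ b K k j ≤ cb * ω₁ ^ (k - j))
    (hlam₂ : ∀ K k, lam₂ K k ≤ ℓ₂) (hℓ₂ : 0 ≤ ℓ₂) (hc : 0 ≤ c) (hcb : 0 ≤ cb) (hω₁ : 0 ≤ ω₁) (hν : ω₁ + c < ν) (hμν : (ω₁ + c) ^ 2 ≤ ν) (hν1 : 1 ≤ ν)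
    (hbd : ∀ g ∈ Window θ.γ, ∀ (K k : ℕ) (X : (domSys (F.P K) M (k + 1)).Dom), ∀ φ ∈ sp K k X,
      ‖((S K) k).E (histPrefix g k) φ X‖ ≤ B * Real.exp (-(κE * (domSys (F.P K) M (k + 1)).dj X)))
    (Ec : ℕ → ℕ → Type*) [∀ K k, NormedAddCommGroup (Ec K k)] [∀ K k, NormedSpace ℂ (Ec K k)]
    (ι : letI := θ.instVβ₁; letI := θ.instVβ₂
      (K k : ℕ) → (domSys (F.P K) M (k + 1)).Dom → ((Fin (F.P K).d → Site (F.P K) (k + 1) → θ.Vβ) →L[ℝ] Ec K k))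
    (Φ : (K k : ℕ) → (domSys (F.P K) M (k + 1)).Dom → Ec K k → CPair (F.P K) 𝔸)
    (U : (K k : ℕ) → (domSys (F.P K) M (k + 1)).Dom → Set (Ec K k)) (hU : ∀ K k X, IsOpen (U K k X)) (hrU : ∀ K k X, ball (0 : Ec K k) r ⊆ U K k X)
    (hEhol : ∀ g ∈ Window θ.γ, ∀ (K k : ℕ) (X : (domSys (F.P K) M (k + 1)).Dom),
      DifferentiableOn ℂ (fun z => ((S K) k).E (histPrefix g k) (Φ K k X z) X) (U K k X))
    (hΦemb : letI := θ.instVβ₁; letI := θ.instVβ₂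
      ∀ (K k : ℕ) (X : (domSys (F.P K) M (k + 1)).Dom) (Bf : Fin (F.P K).d → Site (F.P K) (k + 1) → θ.Vβ),
        Φ K k X (ι K k X Bf) = emb K k (fun l t => NormedSpace.exp (θ.ρ8 (Bf l t))))
    (hΦsp : ∀ (K k : ℕ) (X : (domSys (F.P K) M (k + 1)).Dom), ∀ z ∈ ball (0 : Ec K k) r, Φ K k X z ∈ sp K k X)
    (w : (K k : ℕ) → (domSys (F.P K) M (k + 1)).Dom → Site (F.P K) (k + 1) → ℝ) (hw₀ : ∀ K k X t, 0 ≤ w K k X t)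
    (hw : letI := θ.instVβ₁; letI := θ.instVβ₂; letI := θ.instιβ
      ∀ (K k : ℕ) (X : (domSys (F.P K) M (k + 1)).Dom) (l : Fin (F.P K).d) (t : Site (F.P K) (k + 1)) (c : θ.ιβ),
        ‖ι K k X (Pi.single l (Pi.single t (θ.bV c)))‖ ≤ w K k X t)
    (htail : ∀ (K k : ℕ) (X : (domSys (F.P K) M (k + 1)).Dom) (t : Site (F.P K) (k + 1)),
      let e : Site (F.P K) (k + 1) → TPt 4 (domCount (F.P K) M (k + 1) * M) := fun x i => (ZMod.cast (x i) : ZMod (domCount (F.P K) M (k + 1) * M))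
      w K k X t ≤ B₃ * Real.exp (-δ₀ * distCT (domCount (F.P K) M (k + 1)) M (e t) (nearT (M := M) (e t) X)))
    (hκ₅ : delta1 δ₀ κ ((M : ℝ) * 4) ≤ κ₅)
    (hω : 0 < ℓ.ω) (hθω : ℓ.θ₅ * ν ≤ ℓ.ω ^ 2) (hℓκ : ℓ.κ ≤ delta1 δ₀ κ ((M : ℝ) * 4))
    (hC₉ : (4 * (2 * C₅ / (1 - ℓ.θ₅) + 2 * ((16 * B * B₃ ^ 2 / r ^ 2) * Real.exp (delta1 δ₀ κ ((M : ℝ) * 4) * ((M : ℝ) * 4) * 3) * K₀ (4 * 2 ^ 4) (2 * 4) * K₁ 4 (δ₀ / 2))) / θ.γ +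
        ((16 * max ℓ₂ (cb * ℓ₁ ^ 2 / (ν - ω₁ - c)) * B₃ ^ 2 / r ^ 2) * Real.exp (delta1 δ₀ κ ((M : ℝ) * 4) * ((M : ℝ) * 4) * 3) * K₀ (4 * 2 ^ 4) (2 * 4) *
          K₁ 4 (δ₀ / 2)) * θ.γ / 2) / ℓ.ω ≤ ℓ.C₉) (k : ℕ) :
    N22At (u3OfRecord₁₃ θ (objectsOfRecord₁₃ F N θ ℓ) k) :=
  (n22At_u3OfRecord₁₃_objectsOfRecord₁₃_iff F N θ ℓ hs k).2
    (ne9_EA_objectsOfRecord₁₃_of_kernelStepRate_termStepRecursion F N θ ℓ hs hγ hlim hC₅ h5 m' M hM S emb hloc sp hκ₀ hδ₀ hB₃ hr hB hκE hT1 hlam hℓ₁ hT2last hT2old ha hb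
      hlam₂ hℓ₂ hc hcb hω₁ hν hμν hν1 hbd Ec ι Φ U hU hrU hEhol hΦemb hΦsp w hw₀ hw htail hκ₅ hω hθω hℓκ hC₉)

/-! ## §3 ★★★ The N22 pin face in term-level recursion currency -/

open Classical Finset in
/-- ★★★ **THE N22 PIN FACE IN TERM-LEVEL RECURSION CURRENCY**: under K3's node-U3 pin at the tuple (`hpin`), §1's inputs at `θ.toStage13Params` give
`N22At (rateCarriersOfRecord₁₃CoPH 𝔯 F θ hP g₀ os k).u3` for EVERY run length `k` — dag-n22-w3's `n22At_rateCarriers_of_kernels_pin_of_ne9` fed with §1.  THE N22 ROW SENTENCE in this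
currency: «node N18's kernel step rate of record + the first- and second-order step schemas of the recursion on the (2.13) TERMS of every torus tower with geometrically weighted
channels + the printed-type output bound + term holomorphy through the readings + tails + W1-20's law + (1.21) + letter rows with `ℓ.θ₅·ν ≤ ℓ.ω²` ⇒ §2b `h9` ∕ `N22At` — NO smallness
of the recursion's growth».  LOCATED (hypothesis form); N22 NOT discharged. [folklore] -/
theorem n22At_rateCarriers_of_kernels_pin_of_kernelStepRate_termStepRecursion (𝔯 : RateReading₁₃CoPH N) (θ : Stage13HParams F N) (hP : θ.Provisos₁₃CoPH F N)
    (g₀ : ℕ → ℝ) (os : List (ULoop F)) (ℓ : U3Letters₁₁) (hs : ℓ.Signs) (hγ : 0 < θ.γ)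
    (hpin : (𝔯.lit F θ hP g₀ os).u3 = objectsOfRecord₁₃ F N θ.toStage13Params ℓ)
    (hlim : PolLimitsExistOfRecord₁₃ F N θ.toStage13Params) {κ₅ C₅ : ℝ} (hC₅ : 0 ≤ C₅) (h5 : KernelStepRateOfRecord₁₃ F N θ.toStage13Params κ₅ ℓ.θ₅ C₅)
    (m' : ℕ) (M : ℕ) [NeZero M] (hM : M = F.L ^ m')
    (S : (K : ℕ) → ClusterTower (F.P K) 𝔸 M) (emb : ReadingMaps F (MatA N) 𝔸) (hloc : Localizes17OfRecord₁₃ F N θ.toStage13Params S emb)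
    (sp : (K k : ℕ) → (domSys (F.P K) M (k + 1)).Dom → Set (CPair (F.P K) 𝔸))
    {κ κE δ₀ B₃ r B ℓ₁ ℓ₂ c cb ω₁ ν : ℝ} {lam lam₂ : ℕ → ℕ → ℝ} {a b : ℕ → ℕ → ℕ → ℝ}
    (hκ₀ : kappa₀ (4 * 2 ^ 4) (2 * 4) ≤ κ / 2) (hδ₀ : 0 < δ₀) (hB₃ : 0 ≤ B₃) (hr : 0 < r) (hB : 0 ≤ B) (hκE : κ ≤ κE)
    (hT1 : ∀ K, ∀ g ∈ Window θ.γ, ∀ g' ∈ Window θ.γ, ∀ (D : ℕ → ℝ) (k : ℕ),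
      (∀ k' < k, ∀ (X' : (domSys (F.P K) M (k' + 1)).Dom), ∀ φ' ∈ sp K k' X',
        ‖termC (S K) (k' + 1) X' g φ' - termC (S K) (k' + 1) X' g' φ'‖ ≤ Real.exp (-(κE * (domSys (F.P K) M (k' + 1)).dj X')) * D (k' + 1)) →
      ∀ (X : (domSys (F.P K) M (k + 1)).Dom), ∀ φ ∈ sp K k X,
        ‖termC (S K) (k + 1) X g φ - termC (S K) (k + 1) X g' φ‖ ≤
          Real.exp (-(κE * (domSys (F.P K) M (k + 1)).dj X)) * (lam K k * |g k - g' k| + ∑ j ∈ range (k + 1), a K k j * D j))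
    (hlam : ∀ K k, lam K k ≤ ℓ₁) (hℓ₁ : 0 ≤ ℓ₁)
    (hT2last : ∀ K, ∀ g ∈ Window θ.γ, ∀ (k : ℕ) (t d : ℝ), 0 < d → t - d ∈ Ioc (0 : ℝ) θ.γ → t + d ∈ Ioc (0 : ℝ) θ.γ →
      ∀ (X : (domSys (F.P K) M (k + 1)).Dom), ∀ φ ∈ sp K k X,
        ‖termC (S K) (k + 1) X (Function.update g k (t + d)) φ - 2 * termC (S K) (k + 1) X (Function.update g k t) φ +
            termC (S K) (k + 1) X (Function.update g k (t - d)) φ‖ ≤ Real.exp (-(κE * (domSys (F.P K) M (k + 1)).dj X)) * (lam₂ K k * d ^ 2))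
    (hT2old : ∀ K, ∀ g ∈ Window θ.γ, ∀ (i : ℕ) (t d : ℝ), 0 < d → t - d ∈ Ioc (0 : ℝ) θ.γ → t + d ∈ Ioc (0 : ℝ) θ.γ →
      ∀ (D₁ D₂ : ℕ → ℝ) (k : ℕ), i < k →
        (∀ k' < k, ∀ (X' : (domSys (F.P K) M (k' + 1)).Dom), ∀ φ' ∈ sp K k' X',
          ‖termC (S K) (k' + 1) X' (Function.update g i (t + d)) φ' - termC (S K) (k' + 1) X' (Function.update g i t) φ'‖ ≤
              Real.exp (-(κE * (domSys (F.P K) M (k' + 1)).dj X')) * D₁ (k' + 1) ∧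
          ‖termC (S K) (k' + 1) X' (Function.update g i t) φ' - termC (S K) (k' + 1) X' (Function.update g i (t - d)) φ'‖ ≤
              Real.exp (-(κE * (domSys (F.P K) M (k' + 1)).dj X')) * D₁ (k' + 1) ∧
          ‖termC (S K) (k' + 1) X' (Function.update g i (t + d)) φ' - 2 * termC (S K) (k' + 1) X' (Function.update g i t) φ' +
              termC (S K) (k' + 1) X' (Function.update g i (t - d)) φ'‖ ≤ Real.exp (-(κE * (domSys (F.P K) M (k' + 1)).dj X')) * D₂ (k' + 1)) →
        ∀ (X : (domSys (F.P K) M (k + 1)).Dom), ∀ φ ∈ sp K k X,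
          ‖termC (S K) (k + 1) X (Function.update g i (t + d)) φ - 2 * termC (S K) (k + 1) X (Function.update g i t) φ +
              termC (S K) (k + 1) X (Function.update g i (t - d)) φ‖ ≤
            Real.exp (-(κE * (domSys (F.P K) M (k + 1)).dj X)) * ∑ j ∈ range (k + 1), (a K k j * D₂ j + b K k j * D₁ j ^ 2))
    (ha : ∀ K k j, j ≤ k → 0 ≤ a K k j ∧ a K k j ≤ c * ω₁ ^ (k - j)) (hb : ∀ K k j, j ≤ k → 0 ≤ b K k j ∧ b K k j ≤ cb * ω₁ ^ (k - j))
    (hlam₂ : ∀ K k, lam₂ K k ≤ ℓ₂) (hℓ₂ : 0 ≤ ℓ₂) (hc : 0 ≤ c) (hcb : 0 ≤ cb) (hω₁ : 0 ≤ ω₁) (hν : ω₁ + c < ν) (hμν : (ω₁ + c) ^ 2 ≤ ν) (hν1 : 1 ≤ ν)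
    (hbd : ∀ g ∈ Window θ.γ, ∀ (K k : ℕ) (X : (domSys (F.P K) M (k + 1)).Dom), ∀ φ ∈ sp K k X,
      ‖((S K) k).E (histPrefix g k) φ X‖ ≤ B * Real.exp (-(κE * (domSys (F.P K) M (k + 1)).dj X)))
    (Ec : ℕ → ℕ → Type*) [∀ K k, NormedAddCommGroup (Ec K k)] [∀ K k, NormedSpace ℂ (Ec K k)]
    (ι : letI := θ.instVβ₁; letI := θ.instVβ₂
      (K k : ℕ) → (domSys (F.P K) M (k + 1)).Dom → ((Fin (F.P K).d → Site (F.P K) (k + 1) → θ.Vβ) →L[ℝ] Ec K k))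
    (Φ : (K k : ℕ) → (domSys (F.P K) M (k + 1)).Dom → Ec K k → CPair (F.P K) 𝔸)
    (U : (K k : ℕ) → (domSys (F.P K) M (k + 1)).Dom → Set (Ec K k)) (hU : ∀ K k X, IsOpen (U K k X)) (hrU : ∀ K k X, ball (0 : Ec K k) r ⊆ U K k X)
    (hEhol : ∀ g ∈ Window θ.γ, ∀ (K k : ℕ) (X : (domSys (F.P K) M (k + 1)).Dom),
      DifferentiableOn ℂ (fun z => ((S K) k).E (histPrefix g k) (Φ K k X z) X) (U K k X))
    (hΦemb : letI := θ.instVβ₁; letI := θ.instVβ₂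
      ∀ (K k : ℕ) (X : (domSys (F.P K) M (k + 1)).Dom) (Bf : Fin (F.P K).d → Site (F.P K) (k + 1) → θ.Vβ),
        Φ K k X (ι K k X Bf) = emb K k (fun l t => NormedSpace.exp (θ.ρ8 (Bf l t))))
    (hΦsp : ∀ (K k : ℕ) (X : (domSys (F.P K) M (k + 1)).Dom), ∀ z ∈ ball (0 : Ec K k) r, Φ K k X z ∈ sp K k X)
    (w : (K k : ℕ) → (domSys (F.P K) M (k + 1)).Dom → Site (F.P K) (k + 1) → ℝ) (hw₀ : ∀ K k X t, 0 ≤ w K k X t)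
    (hw : letI := θ.instVβ₁; letI := θ.instVβ₂; letI := θ.instιβ
      ∀ (K k : ℕ) (X : (domSys (F.P K) M (k + 1)).Dom) (l : Fin (F.P K).d) (t : Site (F.P K) (k + 1)) (c : θ.ιβ),
        ‖ι K k X (Pi.single l (Pi.single t (θ.bV c)))‖ ≤ w K k X t)
    (htail : ∀ (K k : ℕ) (X : (domSys (F.P K) M (k + 1)).Dom) (t : Site (F.P K) (k + 1)),
      let e : Site (F.P K) (k + 1) → TPt 4 (domCount (F.P K) M (k + 1) * M) := fun x i => (ZMod.cast (x i) : ZMod (domCount (F.P K) M (k + 1) * M))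
      w K k X t ≤ B₃ * Real.exp (-δ₀ * distCT (domCount (F.P K) M (k + 1)) M (e t) (nearT (M := M) (e t) X)))
    (hκ₅ : delta1 δ₀ κ ((M : ℝ) * 4) ≤ κ₅)
    (hω : 0 < ℓ.ω) (hθω : ℓ.θ₅ * ν ≤ ℓ.ω ^ 2) (hℓκ : ℓ.κ ≤ delta1 δ₀ κ ((M : ℝ) * 4))
    (hC₉ : (4 * (2 * C₅ / (1 - ℓ.θ₅) + 2 * ((16 * B * B₃ ^ 2 / r ^ 2) * Real.exp (delta1 δ₀ κ ((M : ℝ) * 4) * ((M : ℝ) * 4) * 3) * K₀ (4 * 2 ^ 4) (2 * 4) * K₁ 4 (δ₀ / 2))) / θ.γ +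
        ((16 * max ℓ₂ (cb * ℓ₁ ^ 2 / (ν - ω₁ - c)) * B₃ ^ 2 / r ^ 2) * Real.exp (delta1 δ₀ κ ((M : ℝ) * 4) * ((M : ℝ) * 4) * 3) * K₀ (4 * 2 ^ 4) (2 * 4) *
          K₁ 4 (δ₀ / 2)) * θ.γ / 2) / ℓ.ω ≤ ℓ.C₉) (k : ℕ) :
    N22At (rateCarriersOfRecord₁₃CoPH 𝔯 F θ hP g₀ os k).u3 :=
  n22At_rateCarriers_of_kernels_pin_of_ne9 𝔯 θ hP g₀ os ℓ hs hpin
    (ne9_EA_objectsOfRecord₁₃_of_kernelStepRate_termStepRecursion F N θ.toStage13Params ℓ hs hγ hlim hC₅ h5 m' M hM S emb hloc sp hκ₀ hδ₀ hB₃ hr hB hκE hT1 hlam hℓ₁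
      hT2last hT2old ha hb hlam₂ hℓ₂ hc hcb hω₁ hν hμν hν1 hbd Ec ι Φ U hU hrU hEhol hΦemb hΦsp w hw₀ hw htail hκ₅ hω hθω hℓκ hC₉) k

end YMDAG.N22.KernelFading

end
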